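/-
Copyright: harness cell b2b-lgcu-borel (gen 16).  Honest framing: the VALUE here is a THEOREM
(all primes `p ≥ 61`, conditional on ONE named classical hypothesis — Dickson's list in Serre's
Cartan-normaliser form) — NOT summit progress; the crux item `SubgroupIdentityDesigns`
(stmt-MatrixMultiplication-14079) stays open and untouched.
-/
import Mathlib
import Literature.Barriers.MatrixMultiplication.NormalizerBarrier
import Summits.MatrixMultiplication.MatrixMultiplication.Theorems.LieRankDesigns.Negative.Basics
import Summits.MatrixMultiplication.MatrixMultiplication.Theorems.SubgroupIdentityDesigns.Negative.CellStatus
import Summits.MatrixMultiplication.MatrixMultiplication.Theorems.SubgroupIdentityDesigns.Negative.ScalarLaw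
import Summits.MatrixMultiplication.MatrixMultiplication.Theorems.SubgroupIdentityDesigns.Negative.WitnessFreeVector
import Summits.MatrixMultiplication.MatrixMultiplication.Theorems.SubgroupIdentityDesigns.Negative.ImageCeiling
import Summits.MatrixMultiplication.MatrixMultiplication.Theorems.SubgroupIdentityDesigns.Negative.FullImageSplit
import Summits.MatrixMultiplication.MatrixMultiplication.Theorems.SubgroupIdentityDesigns.Negative.FullImageNonsplit
import Summits.MatrixMultiplication.MatrixMultiplication.Theorems.SubgroupIdentityDesigns.Negative.NormaliserImages

/-!
# The `(2,1)` cell modulo Dickson: no level-one witness for `p ≥ 61`, `0 < ε ≤ 0.98`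

Route `LevelGradedCohnUmans`, crux `SubgroupIdentityDesigns` (stmt-MatrixMultiplication-14079),
negative side, cell `(m,k) = (2,1)`.  This file assembles the landed all-`p` engines into ONE
statement whose only non-Lean input is Dickson's classification of the subgroups of `GL₂(𝔽_p)`
of order prime to `p`, carried as the NAMED HYPOTHESIS `DicksonList p n` in the form of Serre
(*Propriétés galoisiennes des points d'ordre fini des courbes elliptiques*, Invent. Math. 15
(1972), §2.5–2.6; Dickson, *Linear groups* (1901), ch. XII; Hida, *Elementary modular Iwasawa
theory*, p. 320): such a subgroup is conjugate into the normaliser of a split Cartan subgroup (the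
monomial group, `NormaliserImages.IsMonomial`), or into the normaliser of a non-split Cartan
subgroup (`NormaliserImages.IsSingerNormal n`, `n` a fixed non-square — all non-split Cartan
subgroups are conjugate), or its image in `PGL₂(𝔽_p)` is `A₄`, `S₄` or `A₅` (order `≤ 60`).
`DicksonList` is NOT proved here.

UNCONDITIONAL lemmas (all `p ≥ 3`):
* `fixers_of_conj` — fixers of all non-zero vectors transport along a conjugation;
* `image_le_of_conj_monomial`, `image_le_of_conj_singerNormal` — a subgroup WITH A FREE VECTOR that
  is conjugate into a Cartan normaliser has projective image `H Z/Z` of order `≤ p + 1`: by the image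
  dichotomy (`NormaliserImages.image_le_or_cover_*`) the alternative is that the conjugate covers the
  whole normaliser modulo scalars, and then every vector has a non-trivial fixer
  (`FullImageSplit.fixers_of_full_split`, `FullImageNonsplit.fixers_of_full_nonsplit`).
CONDITIONAL assembly:
* `image_le_of_dicksonList` — under `DicksonList p n`, `p ≥ 59`: a `p`-free subgroup with a free
  vector has projective image of order `≤ p + 1`;
* `witness_volume_window_of_dicksonList` — under `DicksonList`, `p ≥ 59`, `0 < ε ≤ 1`: a witness
  triple has `f(3) < |H₁||H₂||H₃| ≤ (p-1)(p+1)³` (what remains for `ε ∈ (0.98, 1]`);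
  `no_levelOne_witness_of_dicksonList_gap` — no witness whenever `(p-1)^{(2+ε)/3} ≤ p - 2`;
* `no_levelOne_witness_of_dicksonList` — **for `p ≥ 61`, `0 < ε ≤ 49/50`, under `DicksonList p n`:
  no subgroup-TPP triple carrying a level-one identity design satisfies the level-one crux
  inequality** `budget p 2 1 (2+ε) < (|H₁||H₂||H₃|)^{(2+ε)/3}` — members are `p`-free
  (`CellStatus.levelOne_witness_pfree_profile`) with a free vector (`WitnessFreeVector`), hence have
  images of order `≤ p + 1`, and `ImageCeiling.no_levelOne_witness_of_image_le` concludes.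

Scope, honestly: `p ≤ 59` is NOT covered (there the sieve data and the `p = 31` certificate census
of ORACLE-g16 apply), `ε ∈ (0.98, 1]` is NOT covered (family-I volumes `(p-1)(p+1)³` exceed the
floor; `p = 61` is settled by an exhaustive certificate census instead), and Dickson's list is an
INPUT.  VALUE = THEOREM, NOT summit progress; the crux item is untouched and remains open.
Report: `run/shared/lean/b2b/levelgraded-cu/ORACLE-g16.md` §G16-1, §G16-2, §G16-6.
-/

set_option linter.dupNamespace false

noncomputable section

open scoped Classical
open Summit.MatrixMultiplication.MatrixMultiplication.Theorems.LieRankDesigns.Negative (GLm Mat budget)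
open Literature.Barriers.MatrixMultiplication (SubgroupTPP)

namespace Summit.MatrixMultiplication.MatrixMultiplication.Theorems.SubgroupIdentityDesigns.Negative

section Dickson

variable {p : ℕ} [hp : Fact p.Prime]

/-- **Dickson's list** (named hypothesis, Serre's Cartan-normaliser form; NOT proved here): every
subgroup of `GL₂(𝔽_p)` of order prime to `p` is conjugate into the monomial group `N(T_s)`, or
into the normaliser `N(C)` of the Singer cycle with parameter `n`, or has projective image of
order at most `60` (`A₄`, `S₄`, `A₅`).  Meaningful for `n` a non-square. -/
def DicksonList (p : ℕ) [Fact p.Prime] (n : ZMod p) : Prop :=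
  ∀ H : Subgroup (GLm p 2), ¬ p ∣ Nat.card H →
    (∃ g : GLm p 2, ∀ x ∈ H, IsMonomial (g * x * g⁻¹)) ∨
    (∃ g : GLm p 2, ∀ x ∈ H, IsSingerNormal n (g * x * g⁻¹)) ∨
    Nat.card (H.map (QuotientGroup.mk' (scalarHom p 2).range)) ≤ 60

/-- Fixers transport along a conjugation `x ↦ g⁻¹ x g` from `H'` into `H`. -/
theorem fixers_of_conj {H H' : Subgroup (GLm p 2)} {g : GLm p 2}
    (hconj : ∀ x ∈ H', g⁻¹ * x * g ∈ H)
    (hfix : ∀ a : Fin 2 → ZMod p, a ≠ 0 →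
      ∃ x ∈ H', x ≠ 1 ∧ ((x : GLm p 2) : Mat p 2).mulVec a = a) :
    ∀ a : Fin 2 → ZMod p, a ≠ 0 →
      ∃ h ∈ H, h ≠ 1 ∧ ((h : GLm p 2) : Mat p 2).mulVec a = a := by
  have hginv : ∀ v : Fin 2 → ZMod p,
      ((g⁻¹ : GLm p 2) : Mat p 2).mulVec (((g : GLm p 2) : Mat p 2).mulVec v) = v := by
    intro v
    rw [Matrix.mulVec_mulVec, ← Units.val_mul, inv_mul_cancel, Units.val_one, Matrix.one_mulVec]
  intro a ha
  have ha' : ((g : GLm p 2) : Mat p 2).mulVec a ≠ 0 := by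
    intro h0
    apply ha
    rw [← hginv a, h0, Matrix.mulVec_zero]
  obtain ⟨x, hx, hne, hfx⟩ := hfix _ ha'
  refine ⟨g⁻¹ * x * g, hconj x hx, ?_, ?_⟩
  · intro h1
    apply hne
    calc x = g * (g⁻¹ * x * g) * g⁻¹ := by group
      _ = 1 := by rw [h1]; group
  · rw [Units.val_mul, Units.val_mul, ← Matrix.mulVec_mulVec, ← Matrix.mulVec_mulVec, hfx, hginv]

/-- A subgroup with a FREE VECTOR has no family of non-trivial fixers of all non-zero vectors. -/
theorem no_fixers_of_free_vector {H : Subgroup (GLm p 2)}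
    (hfree : ∃ a : Fin 2 → ZMod p, a ≠ 0 ∧
      ∀ h ∈ H, ((h : GLm p 2) : Mat p 2).mulVec a = a → h = 1) :
    ¬ ∀ b : Fin 2 → ZMod p, b ≠ 0 →
      ∃ h ∈ H, h ≠ 1 ∧ ((h : GLm p 2) : Mat p 2).mulVec b = b := by
  obtain ⟨a, ha, hfree⟩ := hfree
  intro hfix
  obtain ⟨h, hh, hne, hfx⟩ := hfix a ha
  exact hne (hfree h hh hfx)

/-- UNCONDITIONAL (`p ≥ 3`): a subgroup with a free vector that is conjugate into the monomial group
`N(T_s)` has projective image of order `≤ p + 1`. -/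
theorem image_le_of_conj_monomial (hp3 : 3 ≤ p) {H : Subgroup (GLm p 2)} {g : GLm p 2}
    (hg : ∀ x ∈ H, IsMonomial (g * x * g⁻¹))
    (hfree : ∃ a : Fin 2 → ZMod p, a ≠ 0 ∧
      ∀ h ∈ H, ((h : GLm p 2) : Mat p 2).mulVec a = a → h = 1) :
    Nat.card (H.map (QuotientGroup.mk' (scalarHom p 2).range)) ≤ p + 1 := by
  have hp2 : p ≠ 2 := by omega
  have hmono : ∀ y ∈ H.map (MulAut.conj g).toMonoidHom, IsMonomial y := by
    intro y hy
    have e : y = g * (g⁻¹ * y * g) * g⁻¹ := by group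
    rw [e]
    exact hg _ (mem_map_conj_iff'.mp hy)
  have hconj : ∀ y ∈ H.map (MulAut.conj g).toMonoidHom, g⁻¹ * y * g ∈ H :=
    fun y hy => mem_map_conj_iff'.mp hy
  rcases image_le_or_cover_monomial hp3 hmono with hle | hcov
  · rwa [card_image_conj] at hle
  · exact absurd (fixers_of_conj hconj (fixers_of_full_split hp2 (fun m hm => hcov m hm)))
      (no_fixers_of_free_vector hfree)

/-- UNCONDITIONAL (`p ≥ 3`, `n` a non-square): a subgroup with a free vector that is conjugate into
the Singer-cycle normaliser `N(C)` has projective image of order `≤ p + 1`. -/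
theorem image_le_of_conj_singerNormal (hp3 : 3 ≤ p) {n : ZMod p} (hn : ∀ x : ZMod p, x * x ≠ n)
    {H : Subgroup (GLm p 2)} {g : GLm p 2} (hg : ∀ x ∈ H, IsSingerNormal n (g * x * g⁻¹))
    (hfree : ∃ a : Fin 2 → ZMod p, a ≠ 0 ∧
      ∀ h ∈ H, ((h : GLm p 2) : Mat p 2).mulVec a = a → h = 1) :
    Nat.card (H.map (QuotientGroup.mk' (scalarHom p 2).range)) ≤ p + 1 := by
  have hp2 : p ≠ 2 := by omega
  have hn0 : n ≠ 0 := fun h0 => hn 0 (by rw [h0, mul_zero])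
  have hsing : ∀ y ∈ H.map (MulAut.conj g).toMonoidHom, IsSingerNormal n y := by
    intro y hy
    have e : y = g * (g⁻¹ * y * g) * g⁻¹ := by group
    rw [e]
    exact hg _ (mem_map_conj_iff'.mp hy)
  have hconj : ∀ y ∈ H.map (MulAut.conj g).toMonoidHom, g⁻¹ * y * g ∈ H :=
    fun y hy => mem_map_conj_iff'.mp hy
  rcases image_le_or_cover_singerNormal hp3 hn0 hsing with hle | hcov
  · rwa [card_image_conj] at hle
  · exact absurd (fixers_of_conj hconj (fixers_of_full_nonsplit hp2 hn (fun m hm => hcov m hm)))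
      (no_fixers_of_free_vector hfree)

/-- CONDITIONAL (`p ≥ 59`): under Dickson's list, a `p`-free subgroup with a free vector has
projective image of order `≤ p + 1`. -/
theorem image_le_of_dicksonList (hp59 : 59 ≤ p) {n : ZMod p} (hn : ∀ x : ZMod p, x * x ≠ n)
    (hD : DicksonList p n) {H : Subgroup (GLm p 2)} (hpf : ¬ p ∣ Nat.card H)
    (hfree : ∃ a : Fin 2 → ZMod p, a ≠ 0 ∧
      ∀ h ∈ H, ((h : GLm p 2) : Mat p 2).mulVec a = a → h = 1) :
    Nat.card (H.map (QuotientGroup.mk' (scalarHom p 2).range)) ≤ p + 1 := by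
  have hp3 : 3 ≤ p := by omega
  rcases hD H hpf with ⟨g, hg⟩ | ⟨g, hg⟩ | hsmall
  · exact image_le_of_conj_monomial hp3 hg hfree
  · exact image_le_of_conj_singerNormal hp3 hn hg hfree
  · omega

/-- **The `(2,1)` cell modulo Dickson, all `p ≥ 61`, `0 < ε ≤ 0.98`.**  Under Dickson's list for
the subgroups of `GL₂(𝔽_p)` of order prime to `p`, NO subgroup-TPP triple carrying a level-one
identity design satisfies the level-one crux inequality: the members are `p`-free (`CellStatus`)
with a free vector (`WitnessFreeVector`), so their projective images have order `≤ p + 1`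
(`image_le_of_dicksonList`), and `ImageCeiling.no_levelOne_witness_of_image_le` concludes. -/
theorem no_levelOne_witness_of_dicksonList (hp61 : 61 ≤ p) {n : ZMod p}
    (hn : ∀ x : ZMod p, x * x ≠ n) (hD : DicksonList p n)
    {ε : ℝ} (hε : 0 < ε) (hε1 : ε ≤ 49 / 50)
    {H₁ H₂ H₃ : Subgroup (GLm p 2)} (htpp : SubgroupTPP H₁ H₂ H₃)
    (hdesign : ∃ c : Mat p 2 → ℂ, (∀ M, 1 < M.rank → c M = 0) ∧
      (∑ M, c M * ZMod.stdAddChar (Matrix.trace (M * ((1 : GLm p 2) : Mat p 2)))) = 1 ∧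
      ∀ a ∈ H₁, ∀ b ∈ H₂, ∀ g ∈ H₃, a * b * g ≠ 1 →
        (∑ M, c M *
          ZMod.stdAddChar (Matrix.trace (M * ((a * b * g : GLm p 2) : Mat p 2)))) = 0) :
    ¬ budget p 2 1 (2 + ε) <
      ((Nat.card H₁ * Nat.card H₂ * Nat.card H₃ : ℕ) : ℝ) ^ ((2 + ε) / 3) := by
  intro hwit
  have hp3 : 3 ≤ p := by omega
  have hp59 : 59 ≤ p := by omega
  have hε1' : ε ≤ 1 := by linarith
  obtain ⟨-, pf₁, pf₂, pf₃⟩ := levelOne_witness_pfree_profile hp3 hε hε1' htpp hdesign hwit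
  obtain ⟨fv₁, fv₂, fv₃⟩ := levelOne_witness_free_vector hp3 hε hε1' htpp hdesign hwit
  exact no_levelOne_witness_of_image_le hp61 (by linarith) hε1 htpp
    (image_le_of_dicksonList hp59 hn hD pf₁ fv₁)
    (image_le_of_dicksonList hp59 hn hD pf₂ fv₂)
    (image_le_of_dicksonList hp59 hn hD pf₃ fv₃) hwit

/-- The same with the non-square supplied (`p` odd has one), so that the ONLY hypothesis beyond
the data of the triple is Dickson's list for some non-square parameter. -/
theorem no_levelOne_witness_of_dicksonList' (hp61 : 61 ≤ p)
    (hD : ∀ n : ZMod p, (∀ x : ZMod p, x * x ≠ n) → DicksonList p n)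
    {ε : ℝ} (hε : 0 < ε) (hε1 : ε ≤ 49 / 50)
    {H₁ H₂ H₃ : Subgroup (GLm p 2)} (htpp : SubgroupTPP H₁ H₂ H₃)
    (hdesign : ∃ c : Mat p 2 → ℂ, (∀ M, 1 < M.rank → c M = 0) ∧
      (∑ M, c M * ZMod.stdAddChar (Matrix.trace (M * ((1 : GLm p 2) : Mat p 2)))) = 1 ∧
      ∀ a ∈ H₁, ∀ b ∈ H₂, ∀ g ∈ H₃, a * b * g ≠ 1 →
        (∑ M, c M *
          ZMod.stdAddChar (Matrix.trace (M * ((a * b * g : GLm p 2) : Mat p 2)))) = 0) :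
    ¬ budget p 2 1 (2 + ε) <
      ((Nat.card H₁ * Nat.card H₂ * Nat.card H₃ : ℕ) : ℝ) ^ ((2 + ε) / 3) := by
  have hp2 : p ≠ 2 := by omega
  obtain ⟨n, hn⟩ := FiniteField.exists_nonsquare (F := ZMod p) (by
    rw [ZMod.ringChar_zmod_n]; exact hp2)
  have hn' : ∀ x : ZMod p, x * x ≠ n := by
    intro x hx
    exact hn ⟨x, hx.symm⟩
  exact no_levelOne_witness_of_dicksonList hp61 hn' (hD n hn') hε hε1 htpp hdesign

/-- CONDITIONAL VOLUME WINDOW (`p ≥ 59`, `0 < ε ≤ 1`): under Dickson's list, a subgroup-TPP triple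
with a level-one identity design satisfying the level-one crux inequality has volume in the window
`f(3) = 1 + p³ + (p-2)(p+1)³ < |H₁||H₂||H₃| ≤ (p-1)(p+1)³` (width `3p² + 3p`): the upper bound is
the scalar law with images of order `≤ p + 1`, the lower bound the master floor (`LevelOneFloor`).
This is what remains of the cell for `ε ∈ (0.98, 1]`. -/
theorem witness_volume_window_of_dicksonList (hp59 : 59 ≤ p) {n : ZMod p}
    (hn : ∀ x : ZMod p, x * x ≠ n) (hD : DicksonList p n)
    {ε : ℝ} (hε : 0 < ε) (hε1 : ε ≤ 1)
    {H₁ H₂ H₃ : Subgroup (GLm p 2)} (htpp : SubgroupTPP H₁ H₂ H₃)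
    (hdesign : ∃ c : Mat p 2 → ℂ, (∀ M, 1 < M.rank → c M = 0) ∧
      (∑ M, c M * ZMod.stdAddChar (Matrix.trace (M * ((1 : GLm p 2) : Mat p 2)))) = 1 ∧
      ∀ a ∈ H₁, ∀ b ∈ H₂, ∀ g ∈ H₃, a * b * g ≠ 1 →
        (∑ M, c M *
          ZMod.stdAddChar (Matrix.trace (M * ((a * b * g : GLm p 2) : Mat p 2)))) = 0)
    (hwit : budget p 2 1 (2 + ε) <
      ((Nat.card H₁ * Nat.card H₂ * Nat.card H₃ : ℕ) : ℝ) ^ ((2 + ε) / 3)) :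
    1 + (p : ℝ) ^ 3 + ((p : ℝ) - 2) * ((p : ℝ) + 1) ^ 3 <
        ((Nat.card H₁ * Nat.card H₂ * Nat.card H₃ : ℕ) : ℝ) ∧
      Nat.card H₁ * Nat.card H₂ * Nat.card H₃ ≤ (p - 1) * (p + 1) ^ 3 := by
  have hp3 : 3 ≤ p := by omega
  refine ⟨?_, ?_⟩
  · by_contra hle
    exact no_levelOne_witness_of_volume_le (by linarith) hε1 (not_lt.mp hle) hwit
  · obtain ⟨-, pf₁, pf₂, pf₃⟩ := levelOne_witness_pfree_profile hp3 hε hε1 htpp hdesign hwit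
    obtain ⟨fv₁, fv₂, fv₃⟩ := levelOne_witness_free_vector hp3 hε hε1 htpp hdesign hwit
    have h₁ := image_le_of_dicksonList hp59 hn hD pf₁ fv₁
    have h₂ := image_le_of_dicksonList hp59 hn hD pf₂ fv₂
    have h₃ := image_le_of_dicksonList hp59 hn hD pf₃ fv₃
    have hV := volume_le_of_scalar_index htpp
      ((card_le_scalar_mul_card_image H₁).trans (Nat.mul_le_mul_left _ h₁))
      ((card_le_scalar_mul_card_image H₂).trans (Nat.mul_le_mul_left _ h₂))
      ((card_le_scalar_mul_card_image H₃).trans (Nat.mul_le_mul_left _ h₃))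
    calc Nat.card H₁ * Nat.card H₂ * Nat.card H₃ ≤ (p - 1) * ((p + 1) * (p + 1) * (p + 1)) := hV
      _ = (p - 1) * (p + 1) ^ 3 := by ring

/-- CONDITIONAL, GENERAL GAP FORM (`p ≥ 59`, `0 < ε ≤ 1`): under Dickson's list, whenever
`(p-1)^{(2+ε)/3} ≤ p - 2` (true for every fixed `ε < 1` once `p` is large; e.g. `p ≥ 61` for
`ε ≤ 0.98`, `NearFloorVolume.gap_of_le_sixtyone`), no subgroup-TPP triple with a level-one identity
design satisfies the level-one crux inequality.  The method's reach is exactly "`ε` bounded away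
from `1`". -/
theorem no_levelOne_witness_of_dicksonList_gap (hp59 : 59 ≤ p) {n : ZMod p}
    (hn : ∀ x : ZMod p, x * x ≠ n) (hD : DicksonList p n)
    {ε : ℝ} (hε : 0 < ε) (hε1 : ε ≤ 1)
    (hgap : ((p : ℝ) - 1) ^ ((2 + ε) / 3) ≤ (p : ℝ) - 2)
    {H₁ H₂ H₃ : Subgroup (GLm p 2)} (htpp : SubgroupTPP H₁ H₂ H₃)
    (hdesign : ∃ c : Mat p 2 → ℂ, (∀ M, 1 < M.rank → c M = 0) ∧
      (∑ M, c M * ZMod.stdAddChar (Matrix.trace (M * ((1 : GLm p 2) : Mat p 2)))) = 1 ∧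
      ∀ a ∈ H₁, ∀ b ∈ H₂, ∀ g ∈ H₃, a * b * g ≠ 1 →
        (∑ M, c M *
          ZMod.stdAddChar (Matrix.trace (M * ((a * b * g : GLm p 2) : Mat p 2)))) = 0) :
    ¬ budget p 2 1 (2 + ε) <
      ((Nat.card H₁ * Nat.card H₂ * Nat.card H₃ : ℕ) : ℝ) ^ ((2 + ε) / 3) := by
  intro hwit
  exact no_levelOne_witness_of_volume_le_familyI_nat (by linarith)
    (witness_volume_window_of_dicksonList hp59 hn hD hε hε1 htpp hdesign hwit).2 hgap hwit

end Dickson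

end Summit.MatrixMultiplication.MatrixMultiplication.Theorems.SubgroupIdentityDesigns.Negative

end
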